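import Mathlib
import Literature.Barriers.ValiantsHypothesis.AlgebraicNaturalProofs
import Literature.Computability.AlgebraicComplexity.ArithCircuitProofs
import Literature.Computability.AlgebraicComplexity.SparseCircuitBounds
import Literature.Computability.AlgebraicComplexity.GKSS19DerivativeCost
import Literature.RepresentationTheory.AlgebraicGroups.CayleyOmegaProcess

/-!
# Crux `BarrierLever.DefinableEquations` (stmt-8745) / `SingleSizeEquations` (stmt-8749) —
# DIFFERENTIAL CLOSURE of the equation ideal down the size axis, I: the closure (val-np-p5 g8)

Write `S(n, s)` for the coefficient vectors (on the `N = C(2n,n)` monomials of degree `≤ n`) of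
the `n`-variate polynomials of degree `≤ n` and fan-in-two size `≤ s`, so that
`coeff(SmallCircuits ℂ n b) = S(n, n^b)`, and `I(n, s)` for the polynomials in the `N`
coefficient variables vanishing on `S(n, s)`.  The crux asks for a NONZERO Boolean sum
`E = boolSum H` of level `a` in `I(n, n^b)` (every `b`, eventually in `n`).  This file records the
structural constraint on such `E` that comes for free from the cheapest closure property of small
circuits — adding a scaled monomial `t · x^μ` costs `≤ 2n + 2` gates (`translate_mem`, from the
Literature bound `complexity_monomial_le : L(c·x^m) ≤ 2|m| + 1`) — and that the tree did not have:

* **§2 `iterate_pderiv_vanishes`.**  `E ∈ I(n, s + 2n + 2) ⇒ ∂_μ^a E ∈ I(n, s)` for EVERY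
  coordinate `μ` and EVERY order `a`: the line `coeff(f) + ℂ e_μ = coeff(f + t x^μ)` lies in
  `S(n, s + 2n + 2)`, so `t ↦ E(coeff f + t e_μ)` vanishes identically and all its Taylor
  coefficients `∂_μ^a E(coeff f) / a!` vanish (one-variable Taylor formula of the tree,
  `GKSS2019.iterate_pderiv_eq_factorial_mul_coeff`).  One translation pays for all orders.
* **§3 `iterPderiv_vanishes`.**  Mixed derivatives: `E ∈ I(n, s + k (2n+2)) ⇒ ∂^β E ∈ I(n, s)`
  whenever `β` involves `≤ k` distinct coordinates (any orders) — the cost is the number of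
  DIRECTIONS.  Geometrically: an equation for size `s + k(2n+2)` vanishes on every affine
  coordinate `k`-plane through a point of `S(n, s)`; ideal-theoretically
  `I(n, s + k(2n+2)) ⊆ I(n, s)^{⟨k+1⟩}` along `≤ k` directions (symbolic-power type containment).
* **§4 `constantCoeff_iterPderiv`, `lt_card_support_of_vanishes`.**  Taylor at the origin
  (`(∂^β E)(0) = β! · coeff_β E`) turns §3 at the point `coeff(0) ∈ S(n, 0)` into the support wall
  of `…Status.lean` — every monomial of `E ∈ I(n, s)` involves `> t` coordinates when
  `t (2n+2) ≤ s` — now for EVERY size bound `s` (Status: `s = n^b`); the wall is the special case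
  "evaluate the closure at the origin".
* **§5** the rungs of the crux: `E ∈ I(SmallCircuits n b)` ⇒ `∂^β E ∈ I(SmallCircuits n b')` for
  `#supp β ≤ k`, `n^{b'} + k(2n+2) ≤ n^b` (`iterPderiv_vanishes_on_smallCircuits`); e.g. at
  `b = 2` every equation vanishes with all derivatives in `≤ (n-3)/2` coordinates on
  `SmallCircuits n 1`, and with all derivatives in `≤ n/4 - 1` coordinates on the size-`n²/2` class.

Part II (`…DifferentialClosureWitness.lean`) shows that the crux's Boolean-sum WITNESSES descend
the size axis by differentiation (`∂_μ` commutes with `boolSum`, costs a level `a ↦ 2a+2`, and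
keeps the sum nonzero).

ROUTE-INDEPENDENT (imports no `Theses` file: everything is about the Literature classes
`SmallCircuits`, `degLEMonomials`, `coeffVector`, `complexity`).

What this is NOT.  No verdict on the crux moves (b = 2 = Chatterjee–Tengse arXiv:2309.07612
§1.3 direction 2, OPEN); nothing here bears on `VP ≠ VNP`.  It is a necessary condition every
candidate `E` (tableau / highest-weight / combinatorial, cf. the g5–g7 normal forms) must pass:
`E` is singular to order `≈ n^{b-b'}/2` (in the number of directions) along the size-`n^{b'}`
class, in particular along every product of `n/2` affine forms, every `n/(2 log n)`-term sum of
`n`-th powers of linear forms, every sparse polynomial.  No definitions, no named facts;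
standard axioms.  Refs: Bürgisser 2000 §2.1 (cost model); Guo–Kumar–Saptharishi–Solomon 2019 §3
(derivatives by interpolation); Sturmfels 1993 §4.3 (differential monomials, tree `iterPderiv`).
-/

-- `Summit.ValiantsHypothesis.ValiantsHypothesis.…` repeats a component by the D-0017 layout
-- (single-conjunct summit), which the `dupNamespace` linter flags; the name is mandated.
set_option linter.dupNamespace false

noncomputable section

namespace Summit.ValiantsHypothesis.ValiantsHypothesis.Theorems.BarrierLeverDefinableEquations

open MvPolynomial
open Literature.Computability.AlgebraicComplexity Literature.Barriers.ValiantsHypothesis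
open Literature.RepresentationTheory.AlgebraicGroups (iterPderiv iterPderiv_add iterPderiv_single
  iterPderiv_zero iterPderiv_monomial iterPderivWeight)
open scoped BigOperators

namespace DifferentialClosure

/-! ## §1 Translating by a monomial: cost and effect on the coefficient vector -/

/-- Adding a scaled monomial of degree `≤ n` to `f` costs at most `2n + 2` gates and keeps the
degree `≤ n`. [folklore] -/
theorem translate_mem {n s : ℕ} {f : MvPolynomial (Fin n) ℂ} (hf : f.totalDegree ≤ n)
    (hL : complexity f ≤ s) (μ : ↥(degLEMonomials n)) (t : ℂ) :
    (f + monomial (μ : Fin n →₀ ℕ) t).totalDegree ≤ n ∧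
      complexity (f + monomial (μ : Fin n →₀ ℕ) t) ≤ s + (2 * n + 2) := by
  have hμ : (μ : Fin n →₀ ℕ).degree ≤ n := μ.2
  refine ⟨(totalDegree_add _ _).trans (max_le hf ?_), ?_⟩
  · refine (totalDegree_monomial_le _ _).trans ?_
    rwa [Finsupp.degree_apply] at hμ
  · have hm := complexity_monomial_le (μ : Fin n →₀ ℕ) t
    calc complexity (f + monomial (μ : Fin n →₀ ℕ) t)
        ≤ complexity f + complexity (monomial (μ : Fin n →₀ ℕ) t : MvPolynomial (Fin n) ℂ) + 1 :=
          complexity_add_le_holds _ _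
      _ ≤ s + (2 * (μ : Fin n →₀ ℕ).degree + 1) + 1 := by gcongr
      _ ≤ s + (2 * n + 2) := by omega

/-- The coefficient vector of `f + t·x^μ` is that of `f` translated by `t` in the coordinate `μ`.
[folklore] -/
theorem coeffVector_translate {n : ℕ} (f : MvPolynomial (Fin n) ℂ) (μ : ↥(degLEMonomials n))
    (t : ℂ) (ν : ↥(degLEMonomials n)) :
    coeffVector (degLEMonomials n) (f + monomial (μ : Fin n →₀ ℕ) t) ν =
      coeffVector (degLEMonomials n) f ν + if ν = μ then t else 0 := by
  rw [coeffVector_apply, coeffVector_apply, coeff_add, coeff_monomial]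
  congr 1
  by_cases h : ν = μ
  · subst h; simp
  · rw [if_neg h, if_neg]
    exact fun h' => h (Subtype.ext h'.symm)

/-- Evaluating `E` at the translated coefficient vector is evaluating the SHIFTED polynomial
`E(…, c_μ + t, …)` at the original one. [folklore] -/
theorem eval_translate {n : ℕ} (f : MvPolynomial (Fin n) ℂ) (μ : ↥(degLEMonomials n)) (t : ℂ)
    (E : MvPolynomial ↥(degLEMonomials n) ℂ) :
    eval (coeffVector (degLEMonomials n) (f + monomial (μ : Fin n →₀ ℕ) t)) E =
      eval (coeffVector (degLEMonomials n) f)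
        (aeval (fun i => if i = μ then X i + C t else X i) E) := by
  have h : aeval (fun i : ↥(degLEMonomials n) =>
      if i = μ then X i + C t else (X i : MvPolynomial ↥(degLEMonomials n) ℂ)) E =
      bind₁ (fun i => if i = μ then X i + C t else X i) E := rfl
  rw [h]
  show eval₂Hom (RingHom.id ℂ) _ E = eval₂Hom (RingHom.id ℂ) _ (bind₁ _ E)
  rw [eval₂Hom_bind₁]
  congr 2
  funext ν
  rw [coeffVector_translate]
  split_ifs with h
  · simp
  · simp

/-! ## §2 One cheap direction kills ALL derivatives in that direction -/

/-- **Differential closure, one coordinate, all orders.**  If `E` vanishes at the coefficient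
vector of every polynomial of degree `≤ n` and circuit size `≤ s + (2n + 2)`, then for every
coefficient coordinate `μ` and every order `a`, the iterated partial derivative `∂_μ^a E`
vanishes at the coefficient vector of every polynomial of degree `≤ n` and size `≤ s`.
Reason: for such `f` the whole line `coeff(f) + ℂ·e_μ = coeff(f + t x^μ)` consists of
coefficient vectors of size `≤ s + 2n + 2`, so the univariate polynomial `t ↦ E(coeff f + t e_μ)`
vanishes identically, and its Taylor coefficients at `t = 0` are `∂_μ^a E(coeff f) / a!`
(`GKSS2019.iterate_pderiv_eq_factorial_mul_coeff`). [folklore] -/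
theorem iterate_pderiv_vanishes {n s : ℕ} {E : MvPolynomial ↥(degLEMonomials n) ℂ}
    (hE : ∀ g : MvPolynomial (Fin n) ℂ, g.totalDegree ≤ n → complexity g ≤ s + (2 * n + 2) →
      eval (coeffVector (degLEMonomials n) g) E = 0)
    (μ : ↥(degLEMonomials n)) (a : ℕ)
    (f : MvPolynomial (Fin n) ℂ) (hf : f.totalDegree ≤ n) (hL : complexity f ≤ s) :
    eval (coeffVector (degLEMonomials n) f) ((pderiv μ)^[a] E) = 0 := by
  have h1 := GKSS2019.iterate_pderiv_eq_factorial_mul_coeff μ E a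
  have h2 := fun t : ℂ => GKSS2019.eval_aeval_taylorVar μ E (C t)
  set T := aeval (fun i => Polynomial.C (X i) +
      if i = μ then (Polynomial.X : Polynomial (MvPolynomial ↥(degLEMonomials n) ℂ)) else 0) E
    with hT
  set φ := eval (coeffVector (degLEMonomials n) f) with hφ
  -- the univariate polynomial `t ↦ E(coeff f + t e_μ)` and its vanishing
  have hP : T.map φ = 0 := by
    refine Polynomial.funext fun t => ?_
    rw [Polynomial.eval_zero, Polynomial.eval_map, show t = φ (C t) by rw [hφ, eval_C],
      Polynomial.eval₂_at_apply, h2 t, hφ, ← eval_translate]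
    obtain ⟨hdeg, hsize⟩ := translate_mem hf hL μ t
    exact hE _ hdeg hsize
  have hcoeff : φ (T.coeff a) = 0 := by
    rw [← Polynomial.coeff_map, hP, Polynomial.coeff_zero]
  rw [h1, map_mul, hcoeff, mul_zero]

/-! ## §3 Mixed derivatives: the cost is the number of DIRECTIONS, not the order -/

/-- `∂^{a·e_μ} = ∂_μ^a`: the tree's iterated partial derivative `iterPderiv` on a one-point
support is the iterate of Mathlib's `pderiv`. [folklore] -/
theorem iterPderiv_single_eq_iterate {σ : Type*} (μ : σ) (a : ℕ) (E : MvPolynomial σ ℂ) :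
    iterPderiv (A := ℂ) (Finsupp.single μ a) E = (pderiv μ)^[a] E := by
  induction a generalizing E with
  | zero => rw [Finsupp.single_zero, iterPderiv_zero, LinearMap.id_apply, Function.iterate_zero_apply]
  | succ a ih =>
    rw [Finsupp.single_add, iterPderiv_add, LinearMap.comp_apply, iterPderiv_single,
      Function.iterate_succ_apply, ← ih]
    rfl

/-- **Differential closure, mixed derivatives.**  If `E` vanishes at the coefficient vector of
every polynomial of degree `≤ n` and size `≤ s + #supp(β) · (2n + 2)`, then the mixed partial
derivative `∂^β E` (any orders, `#supp β` distinct coordinates) vanishes at the coefficient vector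
of every polynomial of degree `≤ n` and size `≤ s`: each new direction costs one translation
`2n + 2`, all orders in an already-paid direction are free (§2).  Equivalently: an equation for
size `s + k(2n+2)` vanishes on every affine coordinate `k`-plane `coeff(f) + span{e_μ : μ ∈ T}`,
`#T ≤ k`, through a point of size `≤ s`. [folklore] -/
theorem iterPderiv_vanishes {n : ℕ} (β : ↥(degLEMonomials n) →₀ ℕ) :
    ∀ {s : ℕ} {E : MvPolynomial ↥(degLEMonomials n) ℂ},
      (∀ g : MvPolynomial (Fin n) ℂ, g.totalDegree ≤ n →
        complexity g ≤ s + β.support.card * (2 * n + 2) →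
        eval (coeffVector (degLEMonomials n) g) E = 0) →
      ∀ f : MvPolynomial (Fin n) ℂ, f.totalDegree ≤ n → complexity f ≤ s →
        eval (coeffVector (degLEMonomials n) f) (iterPderiv (A := ℂ) β E) = 0 := by
  induction β using Finsupp.induction with
  | zero =>
    intro s E hE f hf hL
    rw [iterPderiv_zero, LinearMap.id_apply]
    exact hE f hf (by simpa using hL)
  | single_add μ a β hμ ha ih =>
    intro s E hE f hf hL
    have hcard : (Finsupp.single μ a + β).support.card = β.support.card + 1 := by
      rw [Finsupp.support_add_eq, Finsupp.support_single _ ha,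
        Finset.card_union_of_disjoint, Finset.card_singleton, add_comm]
      · rw [Finset.disjoint_singleton_left]; exact hμ
      · rw [Finsupp.support_single _ ha, Finset.disjoint_singleton_left]; exact hμ
    rw [hcard] at hE
    rw [iterPderiv_add, LinearMap.comp_apply, iterPderiv_single_eq_iterate]
    -- all orders in the direction `μ` cost one translation …
    refine iterate_pderiv_vanishes (s := s) (fun g hg hgL => ?_) μ a f hf hL
    -- … on top of the `#supp β` translations for `∂^β`
    exact ih (s := s + (2 * n + 2)) (fun g' hg' hg'L => hE g' hg' (by
      simpa [add_mul, add_assoc, add_comm, add_left_comm] using hg'L)) g hg hgL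

/-! ## §4 Taylor coefficients at the origin: the support wall of `…Status` for EVERY size bound -/

/-- Multivariate Taylor at the origin: the constant term of `∂^β E` is `β! · coeff_β E`
(`β! = iterPderivWeight β β = ∏_μ (β μ)!`). [folklore] -/
theorem constantCoeff_iterPderiv {σ : Type*} (β : σ →₀ ℕ) (E : MvPolynomial σ ℂ) :
    constantCoeff (iterPderiv (A := ℂ) β E) = (iterPderivWeight β β : ℂ) * coeff β E := by
  classical
  conv_lhs => rw [E.as_sum, map_sum, map_sum]
  simp only [iterPderiv_monomial, constantCoeff_monomial]
  rw [Finset.sum_eq_single β]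
  · rw [if_pos (tsub_self β), mul_comm]
  · intro s _ hs
    split_ifs with h0
    · -- `s - β = 0` and `s ≠ β`: some `q` has `s q < β q`, so the falling factorial vanishes
      have hle : s ≤ β := tsub_eq_zero_iff_le.mp h0
      obtain ⟨q, hq⟩ : ∃ q, s q < β q := by
        by_contra hcon
        push Not at hcon
        exact hs (le_antisymm hle fun q => hcon q)
      have hw : iterPderivWeight β s = 0 := by
        unfold iterPderivWeight
        rw [Finsupp.prod]
        exact Finset.prod_eq_zero (Finsupp.mem_support_iff.mpr (by omega))
          (Nat.descFactorial_eq_zero_iff_lt.mpr hq)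
      rw [hw, Nat.cast_zero, mul_zero]
    · rfl
  · intro hβ
    rw [MvPolynomial.notMem_support_iff.mp hβ, zero_mul, if_pos (tsub_self β)]

/-- **Support wall for every size bound** (generalises `Status.lt_card_support_of_vanishes_on_smallCircuits` of the route cone,
which is the case `s = n^b`, to arbitrary `s`, e.g. the linear sizes `c·n`): if `E` vanishes
at the coefficient vector of every polynomial of degree `≤ n` and size `≤ s`, and
`t (2n + 2) ≤ s`, then every monomial of `E` involves `> t` distinct coefficient variables.
Proof FROM THE DIFFERENTIAL CLOSURE: otherwise `∂^β E` (`β` the exponent of the short monomial)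
vanishes at `coeff(0) = 0`, but its value there is `β! · coeff_β E ≠ 0` (§4). [folklore] -/
theorem lt_card_support_of_vanishes {n s t : ℕ} {E : MvPolynomial ↥(degLEMonomials n) ℂ}
    (hE : ∀ g : MvPolynomial (Fin n) ℂ, g.totalDegree ≤ n → complexity g ≤ s →
      eval (coeffVector (degLEMonomials n) g) E = 0)
    (ht : t * (2 * n + 2) ≤ s) {β : ↥(degLEMonomials n) →₀ ℕ} (hβ : β ∈ E.support) :
    t < β.support.card := by
  by_contra hle
  push Not at hle
  have hL0 : complexity (0 : MvPolynomial (Fin n) ℂ) ≤ 0 := by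
    rw [← C_0]; exact (complexity_C_holds (σ := Fin n) (0 : ℂ)).le
  have hvan := iterPderiv_vanishes β (s := 0) (E := E) (fun g hg hgL => hE g hg
    (hgL.trans (by nlinarith [Nat.zero_le n]))) 0 (by rw [totalDegree_zero]; exact Nat.zero_le _) hL0
  have h0 : coeffVector (degLEMonomials n) (0 : MvPolynomial (Fin n) ℂ) = 0 := by
    funext ν; rw [coeffVector_apply, coeff_zero]; rfl
  rw [h0, MvPolynomial.eval_zero, constantCoeff_iterPderiv] at hvan
  refine mul_ne_zero ?_ (mem_support_iff.mp hβ) hvan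
  exact_mod_cast (Literature.RepresentationTheory.AlgebraicGroups.iterPderivWeight_self_pos β).ne'

/-! ## §5 Down the size axis of the crux: `SmallCircuits ℂ n b → SmallCircuits ℂ n b'` -/

/-- **Equations for size `n^b` vanish, with all mixed derivatives in `≤ k` coordinates, on
size `n^{b'}`** whenever `n^{b'} + k (2n + 2) ≤ n^b` (symbolic-power containment
`I(SmallCircuits n b) ⊆ I(SmallCircuits n b')^{(k+1)}` restricted to `k` directions; e.g.
`b' = b - 1`, `k ≈ n^{b-1}/2 · (1 - 1/n)`). [folklore] -/
theorem iterPderiv_vanishes_on_smallCircuits {n b b' k : ℕ} (hk : n ^ b' + k * (2 * n + 2) ≤ n ^ b)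
    {E : MvPolynomial ↥(degLEMonomials n) ℂ}
    (hE : ∀ f ∈ SmallCircuits ℂ n b, eval (coeffVector (degLEMonomials n) f) E = 0)
    {β : ↥(degLEMonomials n) →₀ ℕ} (hβ : β.support.card ≤ k) :
    ∀ f ∈ SmallCircuits ℂ n b', eval (coeffVector (degLEMonomials n) f) (iterPderiv (A := ℂ) β E) = 0 := by
  intro f hf
  refine iterPderiv_vanishes β (s := n ^ b') (fun g hg hgL => hE g ⟨hg, hgL.trans ?_⟩) f hf.1 hf.2
  calc n ^ b' + β.support.card * (2 * n + 2) ≤ n ^ b' + k * (2 * n + 2) := by gcongr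
    _ ≤ n ^ b := hk

/-- **One coordinate, all orders, one rung down**: if `n^{b'} + 2n + 2 ≤ n^b` (e.g. `b' + 1 ≤ b`,
`n ≥ 4`) then every `∂_μ^a E` of an equation `E` for `SmallCircuits ℂ n b` is an equation (possibly
zero) for `SmallCircuits ℂ n b'`. [folklore] -/
theorem iterate_pderiv_vanishes_on_smallCircuits {n b b' : ℕ} (h : n ^ b' + (2 * n + 2) ≤ n ^ b)
    {E : MvPolynomial ↥(degLEMonomials n) ℂ}
    (hE : ∀ f ∈ SmallCircuits ℂ n b, eval (coeffVector (degLEMonomials n) f) E = 0)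
    (μ : ↥(degLEMonomials n)) (a : ℕ) :
    ∀ f ∈ SmallCircuits ℂ n b', eval (coeffVector (degLEMonomials n) f) ((pderiv μ)^[a] E) = 0 :=
  fun f hf => iterate_pderiv_vanishes (s := n ^ b') (fun g hg hgL => hE g ⟨hg, hgL.trans h⟩)
    μ a f hf.1 hf.2

/-- Arithmetic of the rungs: `n^{b'} + 2n + 2 ≤ n^b` as soon as `1 ≤ b' < b` and `n ≥ 4`.
[folklore] -/
theorem pow_add_translate_le {n b b' : ℕ} (hb' : 1 ≤ b') (hb : b' + 1 ≤ b) (hn : 4 ≤ n) :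
    n ^ b' + (2 * n + 2) ≤ n ^ b := by
  have h1 : n ^ b' * n ≤ n ^ b := by
    rw [← pow_succ]; exact Nat.pow_le_pow_right (by omega) hb
  have h3 : n ≤ n ^ b' := by
    calc n = n ^ 1 := (pow_one n).symm
      _ ≤ n ^ b' := Nat.pow_le_pow_right (by omega) hb'
  nlinarith

end DifferentialClosure

end Summit.ValiantsHypothesis.ValiantsHypothesis.Theorems.BarrierLeverDefinableEquations
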